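import Literature.NumberTheory.Automorphic.HidaTowerLevels
import Literature.NumberTheory.Automorphic.HidaTowerHeckeCommutative
import HarnessLib

/-!
# Hecke operators commute with the pull-backs between the two-parameter Hida levels `U(b, c)`

Topic `NumberTheory/Automorphic`; namespace `Literature.NumberTheory.Automorphic.BigHeckeGLn.TameLevel`;
theorems only.  Proof file supporting the named fact
`Literature.NumberTheory.Automorphic.hidaControl_dominantOrdinaryPoint` (Hida's control theorem):
[KhareThorne2017, §6.2, Lemma 6.5 (2)] — the operators `U_{v,i}` (`v ∣ p`), the diamond operators
`⟨u⟩_v` and the spherical `T_{w,j}` (`w ∉ S`) commute with the natural maps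
`H^•(X_{U(b,c)}, M) → H^•(X_{U(b',c')}, M)` (`b ≤ b'`, `c ≤ c'`) — for the two-parameter levels
`level b c = U(b, c)` (and the general `levelAt Λ`) of `HidaTowerLevels`, any `GL_n` over any number
field, `U` maximal above `p`.  The tree had this for the diagonal tower `U(r) = U(r, max r 1)` only
(`bijOn_hidaLevel_heckeElement_of_mem` etc. of `OrdinaryCompletedCohomologyGL`); the proofs are the
same (Iwahori factorisation across the cut, `exists_unipotent_cutDiag_conj_mem`), run with the
`levelAt` membership API:

* `bijOn_levelAt_heckeElement_of_mem` — `U(Λ') t_{v,i} U(Λ') / U(Λ') → U(Λ) t_{v,i} U(Λ) / U(Λ)`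
  is a bijection for `Λ' ≤ Λ` with Iwahori factors `Λ_v = Iw_v(b,c)` (`max b c ≥ 1`),
  `Λ'_v = Iw_v(b',c')`;
* `bijOn_levelAt_heckeElement` (good places), `bijOn_levelAt_of_conj` (normalising elements) and
  `diamondElement_conj_mem_level` (diamonds normalise `U(b,c)`);
* hence (`HeckeTowerCompatibility.heckeOperator_comp_cohomologyPullback`) on cohomology
  **`T_g ≫ res = res ≫ T_g`** for `res : H^q(X_{U(b,c)}, M) → H^q(X_{U(b',c')}, M)` and every Hida
  element `g` (`heckeOperator_comp_cohomologyPullback_level`), [KhareThorne2017, Lemma 6.5 (2)];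
* the **diamond operators `⟨u⟩_v` on `H^i(X_{U(b,c)}, M)`** (`v ∣ p`, any `n`): multiplicative in
  `u ∈ T_n(𝒪_v)` (`heckeEnd_level_diamondElement_mul`) and trivial for `u ≡ 1 mod ϖ_v^b`
  (`heckeEnd_level_diamondElement_eq_one`; generic `ArithmeticQuotient.heckeEnd_eq_one_of_mem`:
  `T_g = 1` for `g ∈ L`) — the action of `U(1,c)/U(b,c) ≅ T(b,c)` of [KhareThorne2017, §6.3];
* for `GL₂`: **the Hecke operators of the Hida elements on `H^i(X_{U(b,c)}, M)` pairwise commute**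
  (`heckeFun_level_comm`, `heckeEnd_level_comm`; [KhareThorne2017, Lemma 6.5 (1)]), extending
  `HidaTowerHeckeCommutative` (diagonal tower) to the two-parameter levels by the same argument.

## References

* C. Khare, J. A. Thorne, *Potential automorphy and the Leopoldt conjecture*, Amer. J. Math. 139
  (2017), §6.2, Lemma 6.5 (2) (arXiv:1409.7007, held; read 2026-08-16). [KhareThorne2017]
* P. Allen, F. Calegari, A. Caraiani, T. Gee et al., Ann. of Math. 197 (2023), §2.2.2.
  [AllenCalegariCaraianiGeeEtAl2023]
-/

noncomputable section

open scoped NumberField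
open IsDedekindDomain CategoryTheory

/-! ### Generic: elements of the level act trivially -/

namespace Literature.NumberTheory.Automorphic.ArithmeticQuotient

variable (k : Type) [CommRing k] {Γ 𝒢 : Type} [Group Γ] [Group 𝒢] (ι : Γ →* 𝒢) {L : Subgroup 𝒢}
  (M : Type) [AddCommGroup M] [Module k M]

omit [Group Γ] in
/-- **`T_g = [L g L] = 1` on `Fun(𝒢 ⧸ L, M)` for `g ∈ L`** (`x g L = x L`). [folklore] -/
theorem heckeFun_eq_id_of_mem {g : 𝒢} (hg : g ∈ L) : heckeFun k L g M = LinearMap.id := by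
  refine LinearMap.ext fun f => funext fun c => ?_
  induction c using QuotientGroup.induction_on with
  | H y =>
    rw [heckeFun_apply_mk_of_conj k M (fun l hl => mul_mem (mul_mem (inv_mem hg) hl) hg) f y,
      LinearMap.id_apply]
    congr 1
    exact QuotientGroup.eq.2 (by simpa using inv_mem hg)

/-- `heckeRepHom` of an element of the level is the identity. [folklore] -/
theorem heckeRepHom_eq_id_of_mem {g : 𝒢} (hg : g ∈ L) : heckeRepHom k L g M ι = 𝟙 _ :=
  Rep.hom_ext (Representation.IntertwiningMap.ext (heckeFun_eq_id_of_mem k M hg))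

/-- **`T_g = 1` on `H^i(X_L, M)` for `g ∈ L`.** [folklore] -/
theorem heckeEnd_eq_one_of_mem {g : 𝒢} (hg : g ∈ L) (i : ℕ) : heckeEnd k L g M ι i = 1 := by
  unfold heckeEnd heckeOperator
  rw [heckeRepHom_eq_id_of_mem k ι M hg, groupCohomology.map_id]
  exact ModuleCat.hom_id

end Literature.NumberTheory.Automorphic.ArithmeticQuotient

namespace Literature.NumberTheory.Automorphic.BigHeckeGLn.TameLevel

variable {n : ℕ} {K : Type} [Field K] [NumberField K] {p : ℕ} [Fact p.Prime] (𝒰 : TameLevel n K p)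

variable {Λ Λ' : ∀ v : {v : HeightOneSpectrum (𝓞 K) // (p : 𝓞 K) ∈ v.asIdeal},
  Subgroup (GL (Fin n) (v.1.adicCompletion K))}

/-! ### Good places -/

/-- The `w`-part of an element of `U` lies in every `levelAt Λ`, for a good place `w ∉ S` (the
levels only shrink above `p`, and `U` is hyperspecial at `w`). [folklore] -/
theorem ofLocal_localComponent_mem_levelAt {w : HeightOneSpectrum (𝓞 K)} (hw : w ∉ 𝒰.bad)
    {u : FiniteAdelicGL n K} (hu : u ∈ 𝒰.subgroup) :
    ofLocal n K w (localComponent n K w u) ∈ 𝒰.levelAt Λ := by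
  rw [mem_levelAt_iff]
  refine ⟨𝒰.ofLocal_mem w hw _ (localComponent_mem_valuedCongruenceSubgroup_one
    (𝒰.le_glFiniteIntegralLevel hu) w), fun w' hw' => ?_⟩
  have hne : w' ≠ w := fun h => hw (𝒰.mem_bad_of_mem w (h ▸ hw'))
  rw [localComponent_ofLocal_of_ne hne]
  exact one_mem _

/-- **`t_{w,j}`, `w ∉ S`, has bijectively corresponding double cosets in `levelAt Λ' ≤ levelAt Λ`**
(`U(Λ) = U(Λ') · (U(Λ) ∩ t U(Λ) t⁻¹)` via the `w`-part; conjugation by `t` does not move the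
components above `p`). [cite: KhareThorne2017, §6.2, Lemma 6.5 (2)] -/
theorem bijOn_levelAt_heckeElement (hΛ : ∀ v, Λ' v ≤ Λ v) {w : HeightOneSpectrum (𝓞 K)}
    (hw : w ∉ 𝒰.bad) (j : ℕ) :
    Set.BijOn (Subgroup.quotientMapOfLE (𝒰.levelAt_mono hΛ))
      (ArithmeticQuotient.doubleCosetQuot (𝒰.levelAt Λ') (heckeElement n K w j))
      (ArithmeticQuotient.doubleCosetQuot (𝒰.levelAt Λ) (heckeElement n K w j)) := by
  refine ArithmeticQuotient.bijOn_doubleCosetQuot (𝒰.levelAt_mono hΛ) _ (fun l hl => ?_)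
    (fun l' hl' hc => ?_)
  · have hlU : l ∈ 𝒰.subgroup := 𝒰.levelAt_le Λ hl
    set l' := ofLocal n K w (localComponent n K w l) with hl'def
    have hm1 : localComponent n K w (l'⁻¹ * l) = 1 := by
      rw [map_mul, map_inv, hl'def, localComponent_ofLocal, inv_mul_cancel]
    have hcomm : l'⁻¹ * l * heckeElement n K w j = heckeElement n K w j * (l'⁻¹ * l) := by
      rw [heckeElement_eq_ofLocal]
      exact mul_ofLocal_comm hm1 _
    have hconj : (heckeElement n K w j)⁻¹ * (l'⁻¹ * l) * heckeElement n K w j = l'⁻¹ * l := by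
      rw [mul_assoc, hcomm, ← mul_assoc, inv_mul_cancel, one_mul]
    refine ⟨l', 𝒰.ofLocal_localComponent_mem_levelAt hw hlU,
      (heckeElement n K w j)⁻¹ * (l'⁻¹ * l) * heckeElement n K w j, ?_, by group⟩
    rw [hconj]
    exact mul_mem (inv_mem (𝒰.ofLocal_localComponent_mem_levelAt hw hlU)) hl
  · rw [mem_levelAt_iff] at hl' hc ⊢
    refine ⟨hc.1, fun w' hw' => ?_⟩
    have hne : w' ≠ w := fun h' => hw (𝒰.mem_bad_of_mem w (h' ▸ hw'))
    rw [map_mul, map_mul, map_inv, heckeElement_eq_ofLocal, localComponent_ofLocal_of_ne hne, inv_one,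
      one_mul, mul_one]
    exact hl'.2 w' hw'

/-! ### Normalising elements (diamonds, central elements) -/

/-- **Elements normalising both levels have bijectively corresponding double cosets** (both are the
single coset `gU`). [folklore] -/
theorem bijOn_levelAt_of_conj (hΛ : ∀ v, Λ' v ≤ Λ v) {g : FiniteAdelicGL n K}
    (hg : ∀ x ∈ 𝒰.levelAt Λ, g⁻¹ * x * g ∈ 𝒰.levelAt Λ)
    (hg' : ∀ x ∈ 𝒰.levelAt Λ', g⁻¹ * x * g ∈ 𝒰.levelAt Λ') :
    Set.BijOn (Subgroup.quotientMapOfLE (𝒰.levelAt_mono hΛ))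
      (ArithmeticQuotient.doubleCosetQuot (𝒰.levelAt Λ') g)
      (ArithmeticQuotient.doubleCosetQuot (𝒰.levelAt Λ) g) :=
  ArithmeticQuotient.bijOn_doubleCosetQuot _ _
    (fun l hl => ⟨1, one_mem _, g⁻¹ * l * g, hg l hl, by group⟩) fun l' hl' _ => hg' l' hl'

/-- Conjugation by a diamond element `⟨u⟩_v`, `v ∣ p`, preserves `levelAt Λ` when the local factor
`Λ_v` is normalised by `diag(u)` (`U` maximal above `p`). [folklore] -/
theorem diamondElement_conj_mem_levelAt (h𝒰 : 𝒰.IsMaximalAbove) {v : HeightOneSpectrum (𝓞 K)}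
    (hv : (p : 𝓞 K) ∈ v.asIdeal) (u : Fin n → (v.adicCompletionIntegers K)ˣ)
    (hΛv : ∀ x ∈ Λ ⟨v, hv⟩, (glDiagonal n (v.adicCompletion K) (unitsToLocal n v u))⁻¹ * x *
      glDiagonal n (v.adicCompletion K) (unitsToLocal n v u) ∈ Λ ⟨v, hv⟩)
    {x : FiniteAdelicGL n K} (hx : x ∈ 𝒰.levelAt Λ) :
    (diamondElement n K v u)⁻¹ * x * diamondElement n K v u ∈ 𝒰.levelAt Λ := by
  have hd : ∀ j, Valued.v ((unitsToLocal n v u j : (v.adicCompletion K)ˣ) : v.adicCompletion K) = 1 :=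
    valued_unitsToLocal v u
  have hdU : diamondElement n K v u ∈ 𝒰.subgroup :=
    h𝒰.ofLocal_mem v hv _ (glDiagonal_mem_valuedCongruenceSubgroup_one_of_eq_one hd)
  rw [mem_levelAt_iff] at hx ⊢
  refine ⟨mul_mem (mul_mem (inv_mem hdU) hx.1) hdU, fun w hw => ?_⟩
  rw [map_mul, map_mul, map_inv, diamondElement_apply]
  by_cases hwv : w = v
  · subst hwv
    rw [localComponent_ofLocal]
    exact hΛv _ (hx.2 w hw)
  · rw [localComponent_ofLocal_of_ne hwv, inv_one, one_mul, mul_one]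
    exact hx.2 w hw

/-- **The diamond elements `⟨u⟩_v` normalise every `U(b, c)`** (`T_n(𝒪_v)` normalises `Iw_v(b,c)`,
`glDiagonal_conj_mem_valuedIwahoriSubgroup`). [folklore] -/
theorem diamondElement_conj_mem_level (h𝒰 : 𝒰.IsMaximalAbove) {v : HeightOneSpectrum (𝓞 K)}
    (hv : (p : 𝓞 K) ∈ v.asIdeal) (u : Fin n → (v.adicCompletionIntegers K)ˣ) (b c : ℕ)
    {x : FiniteAdelicGL n K} (hx : x ∈ 𝒰.level b c) :
    (diamondElement n K v u)⁻¹ * x * diamondElement n K v u ∈ 𝒰.level b c :=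
  𝒰.diamondElement_conj_mem_levelAt h𝒰 hv u
    (fun _ hy => glDiagonal_conj_mem_valuedIwahoriSubgroup (valued_unitsToLocal v u) hy) hx

/-! ### Diamond operators at level `U(b, c)` -/

omit [Fact p.Prime] 𝒰 in
/-- A diagonal matrix of units `≡ 1 mod ϖ_v^b` lies in `Iw_v(b, c)`. [folklore] -/
theorem glDiagonal_mem_iwahoriLevel (v : HeightOneSpectrum (𝓞 K)) {b : ℕ} (c : ℕ)
    {d : Fin n → (v.adicCompletion K)ˣ} (hd₁ : ∀ j, Valued.v (d j : v.adicCompletion K) = 1)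
    (hdb : ∀ j, Valued.v ((d j : v.adicCompletion K) - 1) ≤ WithZero.exp (-(b : ℤ))) :
    glDiagonal n (v.adicCompletion K) d ∈ iwahoriLevel n v b c := by
  have key : ∀ e : Fin n → (v.adicCompletion K)ˣ, (∀ j, Valued.v (e j : v.adicCompletion K) = 1) →
      (∀ j, Valued.v ((e j : v.adicCompletion K) - 1) ≤ WithZero.exp (-(b : ℤ))) →
      IwahoriCond (Fin n) (WithZero.exp (-(b : ℤ)) : WithZero (Multiplicative ℤ)) (WithZero.exp (-(c : ℤ)))
        (glDiagonal n (v.adicCompletion K) e : Matrix (Fin n) (Fin n) (v.adicCompletion K)) := by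
    intro e he heb
    refine ⟨fun i j => ?_, fun i j hij => ?_, fun i => ?_⟩
    · rw [coe_glDiagonal, Matrix.diagonal_apply]
      split_ifs
      · exact (he i).le
      · simp
    · rw [coe_glDiagonal, Matrix.diagonal_apply_ne _ (ne_of_gt hij), map_zero]
      exact zero_le
    · rw [coe_glDiagonal, Matrix.diagonal_apply_eq]
      exact heb i
  refine ⟨key d hd₁ hdb, ?_⟩
  rw [← map_inv]
  refine key d⁻¹ (fun j => by rw [Pi.inv_apply, Units.val_inv_eq_inv_val, map_inv₀, hd₁, inv_one])
    fun j => ?_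
  rw [Pi.inv_apply, Units.val_inv_eq_inv_val,
    show ((d j : v.adicCompletion K))⁻¹ - 1 = ((d j : v.adicCompletion K))⁻¹ * (1 - (d j : v.adicCompletion K)) by
      rw [mul_sub, mul_one, inv_mul_cancel₀ (d j).ne_zero],
    map_mul, map_inv₀, hd₁, inv_one, one_mul, Valuation.map_sub_swap]
  exact hdb j

/-- **`⟨u⟩_v ∈ U(b, c)` for `u ≡ 1 mod ϖ_v^b`** (`U` maximal above `p`, `v ∣ p`). [folklore] -/
theorem diamondElement_mem_level (h𝒰 : 𝒰.IsMaximalAbove) {v : HeightOneSpectrum (𝓞 K)}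
    (hv : (p : 𝓞 K) ∈ v.asIdeal) {b : ℕ} (c : ℕ) {u : Fin n → (v.adicCompletionIntegers K)ˣ}
    (hub : ∀ j, Valued.v ((((u j : (v.adicCompletionIntegers K)ˣ) : v.adicCompletionIntegers K) :
      v.adicCompletion K) - 1) ≤ WithZero.exp (-(b : ℤ))) :
    diamondElement n K v u ∈ 𝒰.level b c := by
  rw [diamondElement_apply]
  refine 𝒰.ofLocal_mem_levelAt h𝒰 hv
    (glDiagonal_mem_valuedCongruenceSubgroup_one_of_eq_one (valued_unitsToLocal v u)) ?_
  exact glDiagonal_mem_iwahoriLevel v c (valued_unitsToLocal v u) hub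

/-- **The diamond operators on `H^i(X_{U(b,c)}, M)` are multiplicative**: `⟨u u'⟩_v = ⟨u⟩_v ⟨u'⟩_v`
(`U` maximal above `p`, `v ∣ p`; the diamond elements normalise `U(b, c)`). [cite: KhareThorne2017, §6.3] -/
theorem heckeEnd_level_diamondElement_mul (h𝒰 : 𝒰.IsMaximalAbove) {v : HeightOneSpectrum (𝓞 K)}
    (hv : (p : 𝓞 K) ∈ v.asIdeal) (b c : ℕ) (u u' : Fin n → (v.adicCompletionIntegers K)ˣ)
    (k : Type) [CommRing k] (M : Type) [AddCommGroup M] [Module k M] (i : ℕ) :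
    ArithmeticQuotient.heckeEnd k (𝒰.level b c) (diamondElement n K v (u * u')) M (globalEmbedding n K) i =
      ArithmeticQuotient.heckeEnd k (𝒰.level b c) (diamondElement n K v u) M (globalEmbedding n K) i *
        ArithmeticQuotient.heckeEnd k (𝒰.level b c) (diamondElement n K v u') M (globalEmbedding n K) i := by
  rw [map_mul]
  exact ArithmeticQuotient.heckeEnd_mul_of_conj k (globalEmbedding n K) M
    (fun x hx => 𝒰.diamondElement_conj_mem_level h𝒰 hv u b c hx)
    (fun x hx => 𝒰.diamondElement_conj_mem_level h𝒰 hv u' b c hx) i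

/-- **The diamond operators on `H^i(X_{U(b,c)}, M)` are trivial on `u ≡ 1 mod ϖ_v^b`**: the action
of `T_n(𝒪_v)` factors through the finite quotient `T(b, c)` (`U(1,c)/U(b,c)`).
[cite: KhareThorne2017, §6.3] -/
theorem heckeEnd_level_diamondElement_eq_one (h𝒰 : 𝒰.IsMaximalAbove) {v : HeightOneSpectrum (𝓞 K)}
    (hv : (p : 𝓞 K) ∈ v.asIdeal) {b : ℕ} (c : ℕ) {u : Fin n → (v.adicCompletionIntegers K)ˣ}
    (hub : ∀ j, Valued.v ((((u j : (v.adicCompletionIntegers K)ˣ) : v.adicCompletionIntegers K) :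
      v.adicCompletion K) - 1) ≤ WithZero.exp (-(b : ℤ)))
    (k : Type) [CommRing k] (M : Type) [AddCommGroup M] [Module k M] (i : ℕ) :
    ArithmeticQuotient.heckeEnd k (𝒰.level b c) (diamondElement n K v u) M (globalEmbedding n K) i = 1 :=
  ArithmeticQuotient.heckeEnd_eq_one_of_mem k (globalEmbedding n K) M
    (𝒰.diamondElement_mem_level h𝒰 hv c hub) i

/-! ### Places above `p`: the operators `U_{v,i}` -/

/-- `|ϖ_v| ≤ 1`. [folklore] -/
private theorem valued_uniformizerAt_le_one'' (v : HeightOneSpectrum (𝓞 K)) :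
    Valued.v ((uniformizerAt v : (v.adicCompletion K)ˣ) : v.adicCompletion K) ≤ 1 := by
  rw [valued_coe_uniformizerAt, ← WithZero.exp_zero]
  exact WithZero.exp_le_exp.2 (by norm_num)

/-- `min(|ϖ_v|^b, |ϖ_v|^c) ≤ |ϖ_v|` when `max b c ≥ 1`. [folklore] -/
private theorem min_radius_le' (v : HeightOneSpectrum (𝓞 K)) {b c : ℕ} (hbc : 1 ≤ max b c) :
    min (WithZero.exp (-(b : ℤ)) : WithZero (Multiplicative ℤ)) (WithZero.exp (-(c : ℤ))) ≤
      Valued.v ((uniformizerAt v : (v.adicCompletion K)ˣ) : v.adicCompletion K) := by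
  rw [valued_coe_uniformizerAt]
  rcases le_max_iff.1 hbc with hb | hc
  · exact min_le_of_left_le (WithZero.exp_le_exp.2 (by omega))
  · exact min_le_of_right_le (WithZero.exp_le_exp.2 (by omega))

/-- **`t_{v,i}`, `v ∣ p`, has bijectively corresponding double cosets in `levelAt Λ' ≤ levelAt Λ`
for Iwahori factors at `v`** (`U` maximal above `p`, `Λ_v = Iw_v(b,c)` with `max b c ≥ 1`,
`Λ'_v = Iw_v(b',c')`): from the Iwahori factorisation across the cut `i` at `v`
(`exists_unipotent_cutDiag_conj_mem`: `U(Λ) = ι_v(N(𝒪_v)) · (U(Λ) ∩ t U(Λ) t⁻¹)`) and the stability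
of `Iw_v(b',c')` under `t⁻¹ (·) t` on elements kept integral (`IwahoriCond.cutDiag_conj`).
[cite: KhareThorne2017, §6.2, Lemma 6.5 (2)] -/
theorem bijOn_levelAt_heckeElement_of_mem (h𝒰 : 𝒰.IsMaximalAbove) (hΛ : ∀ w, Λ' w ≤ Λ w)
    {v : HeightOneSpectrum (𝓞 K)} (hv : (p : 𝓞 K) ∈ v.asIdeal) {b c b' c' : ℕ} (hbc : 1 ≤ max b c)
    (hΛv : Λ ⟨v, hv⟩ = iwahoriLevel n v b c) (hΛ'v : Λ' ⟨v, hv⟩ = iwahoriLevel n v b' c') (i : ℕ) :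
    Set.BijOn (Subgroup.quotientMapOfLE (𝒰.levelAt_mono hΛ))
      (ArithmeticQuotient.doubleCosetQuot (𝒰.levelAt Λ') (heckeElement n K v i))
      (ArithmeticQuotient.doubleCosetQuot (𝒰.levelAt Λ) (heckeElement n K v i)) := by
  have hϖ1 := valued_uniformizerAt_le_one'' (K := K) v
  set tl : GL (Fin n) (v.adicCompletion K) := cutDiag (uniformizerAt v) i with htl
  have ht : heckeElement n K v i = ofLocal n K v tl := heckeElement_eq_ofLocal_cutDiag v i
  have hIw_le : ∀ b c : ℕ, iwahoriLevel n v b c ≤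
      valuedCongruenceSubgroup (Fin n) (1 : WithZero (Multiplicative ℤ)) :=
    fun b c => valuedIwahoriSubgroup_le_valuedCongruenceSubgroup_one
  refine ArithmeticQuotient.bijOn_doubleCosetQuot (𝒰.levelAt_mono hΛ) _ (fun l hl => ?_)
    (fun l' hl' hc => ?_)
  · -- (a) Iwahori factorisation at `v`
    obtain ⟨hlU, hlw⟩ := (𝒰.mem_levelAt_iff Λ l).1 hl
    have hlv : localComponent n K v l ∈ iwahoriLevel n v b c := by rw [← hΛv]; exact hlw v hv
    obtain ⟨u, hu, hconj⟩ := exists_unipotent_cutDiag_conj_mem hϖ1 (min_radius_le' v hbc) i hlv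
    have huU : ofLocal n K v u ∈ 𝒰.subgroup := h𝒰.ofLocal_mem v hv u (hIw_le b' c' (hu _ _))
    refine ⟨ofLocal n K v u, ?_, (heckeElement n K v i)⁻¹ * ((ofLocal n K v u)⁻¹ * l) *
      heckeElement n K v i, ?_, by group⟩
    · refine 𝒰.ofLocal_mem_levelAt h𝒰 hv (hIw_le b' c' (hu _ _)) ?_
      rw [hΛ'v]
      exact hu _ _
    · set y := (ofLocal n K v u)⁻¹ * l with hy
      have hyU : y ∈ 𝒰.subgroup := mul_mem (inv_mem huU) hlU
      have hyv : localComponent n K v y = u⁻¹ * localComponent n K v l := by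
        rw [hy, map_mul, map_inv, localComponent_ofLocal]
      have hloc : tl⁻¹ * localComponent n K v y * tl ∈ iwahoriLevel n v b c := by
        rw [hyv]; exact hconj
      rw [ht, ofLocal_inv_mul_mul_ofLocal_eq, mem_levelAt_iff]
      refine ⟨mul_mem (h𝒰.mul_ofLocal_inv_mem v hv y hyU)
        (h𝒰.ofLocal_mem v hv _ (hIw_le b c hloc)), fun w hw => ?_⟩
      by_cases hwv : w = v
      · subst hwv
        simp only [map_mul, map_inv, localComponent_ofLocal, mul_inv_cancel, one_mul]
        rw [hΛv]
        exact hloc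
      · simp only [map_mul, map_inv, localComponent_ofLocal_of_ne hwv, inv_one, mul_one]
        rw [hy, map_mul, map_inv, localComponent_ofLocal_of_ne hwv, inv_one, one_mul]
        exact hlw w hw
  · -- (b) conjugation by `t` preserves the smaller level on elements it keeps integral
    rw [mem_levelAt_iff] at hl' hc ⊢
    refine ⟨hc.1, fun w hw => ?_⟩
    by_cases hwv : w = v
    · subst hwv
      have hcw := hc.2 w hw
      rw [map_mul, map_mul, map_inv, localComponent_heckeElement_self] at hcw ⊢
      rw [hΛv] at hcw
      have hl'w := hl'.2 w hw
      rw [hΛ'v] at hl'w ⊢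
      refine ⟨hl'w.1.cutDiag_conj hϖ1 (topRightDivisible_of_le_one hcw.1.le_one), ?_⟩
      have hinv : ((cutDiag (uniformizerAt w) i)⁻¹ * localComponent n K w l' * cutDiag (uniformizerAt w) i)⁻¹ =
          (cutDiag (uniformizerAt w) i)⁻¹ * (localComponent n K w l')⁻¹ * cutDiag (uniformizerAt w) i := by
        group
      rw [hinv]
      refine hl'w.2.cutDiag_conj hϖ1 (topRightDivisible_of_le_one ?_)
      rw [← hinv]
      exact hcw.2.le_one
    · rw [map_mul, map_mul, map_inv, heckeElement_eq_ofLocal, localComponent_ofLocal_of_ne hwv, inv_one,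
        one_mul, mul_one]
      exact hl'.2 w hw

/-! ### The two-parameter levels `U(b, c)` -/

section Level

variable {b b' c c' : ℕ} (hb : b ≤ b') (hc : c ≤ c')

/-- `U_{v,i}`: bijective double cosets in `U(b',c') ≤ U(b,c)` (`v ∣ p`, `U` maximal above `p`,
`max b c ≥ 1`). [cite: KhareThorne2017, §6.2, Lemma 6.5 (2)] -/
theorem bijOn_level_heckeElement_of_mem (h𝒰 : 𝒰.IsMaximalAbove) (hbc : 1 ≤ max b c)
    {v : HeightOneSpectrum (𝓞 K)} (hv : (p : 𝓞 K) ∈ v.asIdeal) (i : ℕ) :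
    Set.BijOn (Subgroup.quotientMapOfLE (𝒰.level_antitone hb hc))
      (ArithmeticQuotient.doubleCosetQuot (𝒰.level b' c') (heckeElement n K v i))
      (ArithmeticQuotient.doubleCosetQuot (𝒰.level b c) (heckeElement n K v i)) :=
  𝒰.bijOn_levelAt_heckeElement_of_mem h𝒰 (fun w => iwahoriLevel_antitone w.1 hb hc) hv hbc rfl rfl i

/-- `T_{w,j}`, `w ∉ S`: bijective double cosets in `U(b',c') ≤ U(b,c)`. [folklore] -/
theorem bijOn_level_heckeElement {w : HeightOneSpectrum (𝓞 K)} (hw : w ∉ 𝒰.bad) (j : ℕ) :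
    Set.BijOn (Subgroup.quotientMapOfLE (𝒰.level_antitone hb hc))
      (ArithmeticQuotient.doubleCosetQuot (𝒰.level b' c') (heckeElement n K w j))
      (ArithmeticQuotient.doubleCosetQuot (𝒰.level b c) (heckeElement n K w j)) :=
  𝒰.bijOn_levelAt_heckeElement (fun w => iwahoriLevel_antitone w.1 hb hc) hw j

/-- `⟨u⟩_v`, `v ∣ p`: bijective double cosets in `U(b',c') ≤ U(b,c)`. [folklore] -/
theorem bijOn_level_diamondElement (h𝒰 : 𝒰.IsMaximalAbove) {v : HeightOneSpectrum (𝓞 K)}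
    (hv : (p : 𝓞 K) ∈ v.asIdeal) (u : Fin n → (v.adicCompletionIntegers K)ˣ) :
    Set.BijOn (Subgroup.quotientMapOfLE (𝒰.level_antitone hb hc))
      (ArithmeticQuotient.doubleCosetQuot (𝒰.level b' c') (diamondElement n K v u))
      (ArithmeticQuotient.doubleCosetQuot (𝒰.level b c) (diamondElement n K v u)) :=
  𝒰.bijOn_levelAt_of_conj (fun w => iwahoriLevel_antitone w.1 hb hc)
    (fun _ hx => 𝒰.diamondElement_conj_mem_level h𝒰 hv u b c hx)
    fun _ hx => 𝒰.diamondElement_conj_mem_level h𝒰 hv u b' c' hx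

/-- `t_{w,n}^{±1}` (central): bijective double cosets in `U(b',c') ≤ U(b,c)`. [folklore] -/
theorem bijOn_level_heckeElement_self_inv (w : HeightOneSpectrum (𝓞 K)) :
    Set.BijOn (Subgroup.quotientMapOfLE (𝒰.level_antitone hb hc))
      (ArithmeticQuotient.doubleCosetQuot (𝒰.level b' c') (heckeElement n K w n)⁻¹)
      (ArithmeticQuotient.doubleCosetQuot (𝒰.level b c) (heckeElement n K w n)⁻¹) :=
  𝒰.bijOn_levelAt_of_conj (fun w => iwahoriLevel_antitone w.1 hb hc)
    (fun x hx => by rwa [inv_inv, heckeElement_self_mul_comm, mul_assoc, mul_inv_cancel, mul_one])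
    fun x hx => by rwa [inv_inv, heckeElement_self_mul_comm, mul_assoc, mul_inv_cancel, mul_one]

/-- **Every Hecke element of the Hida tower has bijectively corresponding double cosets in
`U(b',c') ≤ U(b,c)`** (`U` maximal above `p`, `max b c ≥ 1`). [cite: KhareThorne2017, §6.2, Lemma 6.5 (2)] -/
theorem bijOn_level_of_mem_hidaElements (h𝒰 : 𝒰.IsMaximalAbove) (hbc : 1 ≤ max b c)
    {g : FiniteAdelicGL n K} (hg : g ∈ 𝒰.hidaElements) :
    Set.BijOn (Subgroup.quotientMapOfLE (𝒰.level_antitone hb hc))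
      (ArithmeticQuotient.doubleCosetQuot (𝒰.level b' c') g)
      (ArithmeticQuotient.doubleCosetQuot (𝒰.level b c) g) := by
  rcases hg with (⟨w, hw, j, rfl⟩ | ⟨w, hw, rfl⟩) | ⟨v, hv, u, rfl⟩
  · rcases hw with hw | hw
    · exact 𝒰.bijOn_level_heckeElement hb hc hw j
    · exact 𝒰.bijOn_level_heckeElement_of_mem hb hc h𝒰 hbc hw j
  · exact 𝒰.bijOn_level_heckeElement_self_inv hb hc w
  · exact 𝒰.bijOn_level_diamondElement hb hc h𝒰 hv u

/-- **The Hecke operators of the Hida tower commute with the pull-backs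
`H^q(X_{U(b,c)}, M) → H^q(X_{U(b',c')}, M)`** (`b ≤ b'`, `c ≤ c'`, `max b c ≥ 1`, `U` maximal above
`p`; `g` a Hida element: `T_{w,j}, T_{w,n}⁻¹, U_{v,j}, U_{v,n}⁻¹, ⟨u⟩_v`) — [KhareThorne2017,
Lemma 6.5 (2)] for the two-parameter levels, in the tree's cohomological model.
[cite: KhareThorne2017, §6.2, Lemma 6.5 (2)] -/
theorem heckeOperator_comp_cohomologyPullback_level (h𝒰 : 𝒰.IsMaximalAbove) (hbc : 1 ≤ max b c)
    {g : FiniteAdelicGL n K} (hg : g ∈ 𝒰.hidaElements) (k : Type) [CommRing k] (M : Type)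
    [AddCommGroup M] [Module k M] (q : ℕ) :
    ArithmeticQuotient.heckeOperator k (𝒰.level b c) g M (globalEmbedding n K) q ≫
        ArithmeticQuotient.cohomologyPullback k (globalEmbedding n K) M (𝒰.level_antitone hb hc) q =
      ArithmeticQuotient.cohomologyPullback k (globalEmbedding n K) M (𝒰.level_antitone hb hc) q ≫
        ArithmeticQuotient.heckeOperator k (𝒰.level b' c') g M (globalEmbedding n K) q :=
  ArithmeticQuotient.heckeOperator_comp_cohomologyPullback k (globalEmbedding n K) M
    (𝒰.level_antitone hb hc) g (𝒰.bijOn_level_of_mem_hidaElements hb hc h𝒰 hbc hg)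
    (finite_orbit_quotient (𝒰.level b c) g) q

end Level

/-! ### `GL₂`: the Hecke operators of `U(b, c)` commute -/

section Commute

omit [Fact p.Prime] 𝒰 in
/-- `t_{w,0} = 1` (private copy; cf. `HidaTowerHeckeCommutative`). [folklore] -/
private theorem heckeElement_zero_eq_one' (w : HeightOneSpectrum (𝓞 K)) : heckeElement n K w 0 = 1 := by
  have h : (fun k : Fin n => if k.val < 0 then uniformizerIdele K w (uniformizerAt w) else 1) = 1 :=
    funext fun k => if_neg (Nat.not_lt_zero _)
  rw [heckeElement, h, map_one]

omit [Fact p.Prime] 𝒰 in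
/-- `t_{w,j} = t_{w,n}` for `j ≥ n` (private copy). [folklore] -/
private theorem heckeElement_of_le' (w : HeightOneSpectrum (𝓞 K)) {j : ℕ} (hj : n ≤ j) :
    heckeElement n K w j = heckeElement n K w n := by
  unfold heckeElement
  congr 1
  funext k
  rw [if_pos (lt_of_lt_of_le k.isLt hj), if_pos k.isLt]

/-- At every Hida place, `U(b, c)` is factorizable with SOME local level (`U` maximal above `p`).
[folklore] -/
theorem exists_isUnramifiedLevel_level (h𝒰 : 𝒰.IsMaximalAbove) (b c : ℕ)
    {w : HeightOneSpectrum (𝓞 K)} (hw : 𝒰.IsHidaPlace w) :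
    ∃ Kw : Subgroup (GL (Fin n) (w.adicCompletion K)),
      ArithmeticQuotient.IsUnramifiedLevel Kw (ofLocal n K w) (localComponent n K w) (𝒰.level b c) := by
  by_cases hp : (p : 𝓞 K) ∈ w.asIdeal
  · exact ⟨_, 𝒰.isUnramifiedLevel_level h𝒰 b c hp⟩
  · exact ⟨_, 𝒰.isUnramifiedLevel_level_of_not_mem b c (Or.resolve_right hw hp)⟩

/-- Different Hida places commute on `Fun(GL_n(𝔸^∞)/U(b,c), M)` (any `n`). [cite: KhareThorne2017, §6.2] -/
theorem heckeFun_level_comm_of_ne (h𝒰 : 𝒰.IsMaximalAbove) (k : Type) [CommRing k] (M : Type)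
    [AddCommGroup M] [Module k M] (b c : ℕ) {v w : HeightOneSpectrum (𝓞 K)} (hv : 𝒰.IsHidaPlace v)
    (hw : 𝒰.IsHidaPlace w) (hvw : v ≠ w) (x : GL (Fin n) (v.adicCompletion K))
    (y : GL (Fin n) (w.adicCompletion K)) :
    ArithmeticQuotient.heckeFun k (𝒰.level b c) (ofLocal n K v x) M ∘ₗ
        ArithmeticQuotient.heckeFun k (𝒰.level b c) (ofLocal n K w y) M =
      ArithmeticQuotient.heckeFun k (𝒰.level b c) (ofLocal n K w y) M ∘ₗ
        ArithmeticQuotient.heckeFun k (𝒰.level b c) (ofLocal n K v x) M := by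
  obtain ⟨Kv, hKv⟩ := 𝒰.exists_isUnramifiedLevel_level h𝒰 b c hv
  obtain ⟨Kw, hKw⟩ := 𝒰.exists_isUnramifiedLevel_level h𝒰 b c hw
  exact ArithmeticQuotient.heckeFun_comm_of_orthogonal k M hKv hKw
    (fun g => localComponent_ofLocal_of_ne (Ne.symm hvw) g) x y

/-- One good place commutes on `Fun(GL_n(𝔸^∞)/U(b,c), M)` (any `n`; Gelfand's trick).
[cite: Bump1997, Thm. 4.6.1] -/
theorem heckeFun_level_comm_of_not_mem (k : Type) [CommRing k] (M : Type) [AddCommGroup M]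
    [Module k M] (b c : ℕ) {w : HeightOneSpectrum (𝓞 K)} (hw : w ∉ 𝒰.bad)
    (x y : GL (Fin n) (w.adicCompletion K)) :
    ArithmeticQuotient.heckeFun k (𝒰.level b c) (ofLocal n K w x) M ∘ₗ
        ArithmeticQuotient.heckeFun k (𝒰.level b c) (ofLocal n K w y) M =
      ArithmeticQuotient.heckeFun k (𝒰.level b c) (ofLocal n K w y) M ∘ₗ
        ArithmeticQuotient.heckeFun k (𝒰.level b c) (ofLocal n K w x) M :=
  ArithmeticQuotient.heckeFun_comm_of_antiInvolution k M (𝒰.isUnramifiedLevel_level_of_not_mem b c hw)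
    (glTranspose (Fin n)) (fun _ hκ => glTranspose_mem_valuedCongruenceSubgroup hκ)
    glTranspose_glTranspose (exists_glTranspose_eq_mul_mul_adicCompletion w (Fin n)) x y

/-- **Shape of the Hida elements of `GL₂` relative to the levels `U(b, c)`**: a Hida element lives at a
Hida place `w`, is diagonal there, and is either `t_{w,1}` or normalises every `U(b, c)` (it is `1`,
central, or a diamond element). [folklore] -/
theorem exists_place_of_mem_hidaElements_level (𝒰 : TameLevel 2 K p) (h𝒰 : 𝒰.IsMaximalAbove)
    {g : FiniteAdelicGL 2 K} (hg : g ∈ 𝒰.hidaElements) :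
    ∃ w : HeightOneSpectrum (𝓞 K), 𝒰.IsHidaPlace w ∧
      (∃ d : Fin 2 → (w.adicCompletion K)ˣ, g = ofLocal 2 K w (glDiagonal 2 (w.adicCompletion K) d)) ∧
      (g = heckeElement 2 K w 1 ∨
        ((∀ b c, ∀ x ∈ 𝒰.level b c, g⁻¹ * x * g ∈ 𝒰.level b c) ∧
          ∀ b c, ∀ x ∈ 𝒰.level b c, g * x * g⁻¹ ∈ 𝒰.level b c)) := by
  rcases hg with (⟨w, hw, j, rfl⟩ | ⟨w, hw, rfl⟩) | ⟨v, hv, u, rfl⟩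
  · refine ⟨w, hw, ⟨_, heckeElement_eq_ofLocal w j⟩, ?_⟩
    rcases Nat.lt_or_ge j 2 with hj | hj
    · interval_cases j
      · refine Or.inr ⟨fun b c x hx => ?_, fun b c x hx => ?_⟩ <;>
          simpa [heckeElement_zero_eq_one'] using hx
      · exact Or.inl rfl
    · have hc : heckeElement 2 K w j ∈ Subgroup.center (FiniteAdelicGL 2 K) := by
        rw [heckeElement_of_le' w hj]
        exact heckeElement_self_mem_center w
      refine Or.inr ⟨fun b c => conj_mem_of_mem_center' hc _, fun b c x hx => ?_⟩
      simpa using conj_mem_of_mem_center' (inv_mem hc) _ x hx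
  · refine ⟨w, hw, ⟨_, by rw [heckeElement_eq_ofLocal, ← map_inv, ← map_inv]⟩, Or.inr ?_⟩
    have hc : heckeElement 2 K w 2 ∈ Subgroup.center (FiniteAdelicGL 2 K) :=
      heckeElement_self_mem_center w
    refine ⟨fun b c x hx => ?_, fun b c x hx => ?_⟩
    · simpa using conj_mem_of_mem_center' (inv_mem hc) _ x hx
    · simpa using conj_mem_of_mem_center' hc _ x hx
  · refine ⟨v, Or.inr hv, ⟨_, diamondElement_apply v u⟩, Or.inr ⟨fun b c x hx =>
      𝒰.diamondElement_conj_mem_level h𝒰 hv u b c hx, fun b c x hx => ?_⟩⟩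
    simpa using 𝒰.diamondElement_conj_mem_level h𝒰 hv u⁻¹ b c hx

/-- **Any two Hecke operators of the Hida elements of `GL₂` commute on `Fun(GL₂(𝔸^∞)/U(b,c), M)`**
(`U` maximal above `p`). [cite: KhareThorne2017, §6.2, Lemma 6.5 (1)] -/
theorem heckeFun_level_comm (𝒰 : TameLevel 2 K p) (h𝒰 : 𝒰.IsMaximalAbove) (k : Type) [CommRing k]
    (M : Type) [AddCommGroup M] [Module k M] (b c : ℕ) {g g' : FiniteAdelicGL 2 K}
    (hg : g ∈ 𝒰.hidaElements) (hg' : g' ∈ 𝒰.hidaElements) :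
    ArithmeticQuotient.heckeFun k (𝒰.level b c) g M ∘ₗ ArithmeticQuotient.heckeFun k (𝒰.level b c) g' M =
      ArithmeticQuotient.heckeFun k (𝒰.level b c) g' M ∘ₗ
        ArithmeticQuotient.heckeFun k (𝒰.level b c) g M := by
  obtain ⟨w, hw, ⟨d, hgd⟩, hgw⟩ := exists_place_of_mem_hidaElements_level 𝒰 h𝒰 hg
  obtain ⟨w', hw', ⟨d', hg'd'⟩, hg'w'⟩ := exists_place_of_mem_hidaElements_level 𝒰 h𝒰 hg'
  by_cases hww' : w = w'
  · subst hww'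
    by_cases hp : (p : 𝓞 K) ∈ w.asIdeal
    · have hcomm : g * g' = g' * g := by
        rw [hgd, hg'd', ← map_mul, ← map_mul, ← map_mul, ← map_mul, mul_comm d d']
      rcases hgw with hgt | ⟨hN, hN'⟩
      · rcases hg'w' with hg't | ⟨hM, hM'⟩
        · rw [hgt, hg't]
        · exact ArithmeticQuotient.heckeFun_comm_of_normalizer k M (hM b c) (hM' b c) hcomm
      · exact (ArithmeticQuotient.heckeFun_comm_of_normalizer k M (hN b c) (hN' b c) hcomm.symm).symm
    · rw [hgd, hg'd']
      exact 𝒰.heckeFun_level_comm_of_not_mem k M b c (Or.resolve_right hw hp) _ _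
  · rw [hgd, hg'd']
    exact 𝒰.heckeFun_level_comm_of_ne h𝒰 k M b c hw hw' hww' _ _

/-- **Any two Hecke operators of the Hida elements of `GL₂` commute on every `H^i(X_{U(b,c)}, M)`.**
[cite: KhareThorne2017, §6.2, Lemma 6.5 (1)] -/
theorem heckeEnd_level_comm (𝒰 : TameLevel 2 K p) (h𝒰 : 𝒰.IsMaximalAbove) (k : Type) [CommRing k]
    (M : Type) [AddCommGroup M] [Module k M] (b c : ℕ) {g g' : FiniteAdelicGL 2 K}
    (hg : g ∈ 𝒰.hidaElements) (hg' : g' ∈ 𝒰.hidaElements) (i : ℕ) :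
    ArithmeticQuotient.heckeEnd k (𝒰.level b c) g M (globalEmbedding 2 K) i *
        ArithmeticQuotient.heckeEnd k (𝒰.level b c) g' M (globalEmbedding 2 K) i =
      ArithmeticQuotient.heckeEnd k (𝒰.level b c) g' M (globalEmbedding 2 K) i *
        ArithmeticQuotient.heckeEnd k (𝒰.level b c) g M (globalEmbedding 2 K) i :=
  ArithmeticQuotient.heckeEnd_comm_of_heckeFun_comm k (globalEmbedding 2 K) M
    (heckeFun_level_comm 𝒰 h𝒰 k M b c hg hg') i

end Commute

end Literature.NumberTheory.Automorphic.BigHeckeGLn.TameLevel
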